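import Literature.MathematicalPhysics.KineticTheory.LangevinChainHormander
import Literature.MathematicalPhysics.KineticTheory.LangevinChainGibbs
import Literature.Analysis.Hypoelliptic.HormanderProof
import Summits.AtomisticToContinuum.FouriersLaw.Theorems.BondHeatUncertaintyLinearResponseFTURNessFacts
import Summits.AtomisticToContinuum.FouriersLaw.Theorems.OddSectorIrreversibilityCorrectorTheoryUniformH2
import HarnessLib

/-!
# Crux `ExtensiveSnapshotIrreversibility` (stmt-AtomisticToContinuum-9121), line `clausius-budget-sound-window`:
stub S1r `stub_logDensityRegularity` — helper file 1 (what the tree gives about the NESS density NOW)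

Support lemmas toward the registered stub S1r of the lead's checked skeleton (v7) of the line — the
regularity statement of the NESS log-density `φ_δ = log (dμ_δ/dμ_T)` of the two-temperature steady
state `μ_δ = μ_{N,T+δ/2,T-δ/2}` of the pinned anharmonic chain `P = pinnedChain ω₂ lam β γ`. This file
assembles the part of clause (R1) ("`μ_δ` is the Gibbs state at `T` reweighted by a density") and the
integrability input of (R2) that the tree already proves, with no new analysis:

* `hasSmoothDensity_of_isSteadyState` — EVERY weak steady state (`OscillatorChain.IsSteadyState`, any
  bath temperatures `T_L, T_R > 0`, `N ≥ 1`) has a `C^∞` nonnegative Lebesgue density: Hörmander's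
  theorem (proved in the tree, `hormander1967_thm11_proof`) through
  `CuneoEckmannHairerReyBellet2018_smoothDensity_of_hormander` (CEHR Prop. 4.1 bracket condition);
  no uniqueness guard is needed;
* `volume_absolutelyContinuous_gibbsMeasure`, `absolutelyContinuous_gibbsMeasure_of_isSteadyState`,
  `eq_withDensity_rnDeriv_gibbsMeasure_of_isSteadyState` — hence `μ ≪ μ_T` for every `T > 0` and
  `μ = μ_T · (dμ/dμ_T)` (clause (R1) up to the POSITIVITY of the density, which is not in the tree for
  the Langevin chain: the Rey-Bellet–Thomas 2002 positivity argument is formalised only for the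
  auxiliary-field model `rbGenerator`, `ReyBelletThomas2002PosDensity.lean`);
* `eq_gibbsMeasure_withDensity_exp_of_pos_density` — the bookkeeping bridge to the SHAPE of (R1): a
  measure with an everywhere positive measurable Lebesgue density `ρ` is `μ_T · e^{φ}` with the explicit
  `φ = log ρ + H/T + log ∫ e^{-H/T}`;
* `ness_uniform_exp_moment` (registered sub-goal) — under weak-NESS uniqueness, along a steady-state
  family, for `T > 0`, `N ≥ 2` and every `0 < θ < 1/T`: there are `δ₀ > 0` and `M` with
  `∫ e^{θH} dμ_{N,T+δ/2,T-δ/2} ≤ M` for ALL `|δ| < δ₀` (uniform-in-`δ` exponential moments: the uniform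
  geometric drift `P_1 e^{θH} ≤ e^{θH}/2 + c` of `…CorrectorTheoryUniformH2` integrated against the
  invariant measure, `ness_facts`).

No new definitions. References: Cuneo–Eckmann–Hairer–Rey-Bellet, EJP 23 (2018) no. 55, Thm 2.13,
Prop. 3.2, Rem. 5.2; L. Hörmander, Acta Math. 119 (1967), Thm 1.1; L. Rey-Bellet, L. E. Thomas,
CMP 225 (2002), Thm 2.1.
-/

noncomputable section

namespace Summit.AtomisticToContinuum.FouriersLaw.Theorems.ExtensiveSnapshotIrreversibility.ClausiusBudget

open MeasureTheory Filter Topology Real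
open scoped ENNReal NNReal
open Literature.MathematicalPhysics.KineticTheory.HeatConduction

namespace LogDensity

variable {N : ℕ}

/-! ## 1. Smooth density of every weak steady state, and `μ ≪ μ_T` -/

/-- **Every weak steady state of the pinned chain has a smooth Lebesgue density** (`ω₂, β, γ > 0`,
`lam ≥ 0`, `N ≥ 1`, `T_L, T_R > 0`): the weak stationarity `∫ L f dμ = 0` (`f ∈ C_c^∞`) makes `μ` a
distributional solution of the hypoelliptic equation `L* μ = 0`.
[cite: CuneoEckmannHairerReyBellet2018, Prop 3.2 and Prop 4.1] [cite: Hormander1967, Thm 1.1] -/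
theorem hasSmoothDensity_of_isSteadyState {ω₂ lam β γ : ℝ} (hω : 0 < ω₂) (hl : 0 ≤ lam)
    (hβ : 0 < β) (hγ : 0 < γ) (hN : 0 < N) {T_L T_R : ℝ} (hL : 0 < T_L) (hR : 0 < T_R)
    {μ : Measure (PhaseSpace N)} (hμ : (pinnedChain ω₂ lam β γ).IsSteadyState N T_L T_R μ) :
    HasSmoothDensity μ := by
  obtain ⟨hprob, hstat, -⟩ := hμ
  exact CuneoEckmannHairerReyBellet2018_smoothDensity_of_hormander
    Literature.Analysis.Hypoelliptic.hormander1967_thm11_proof ω₂ lam β γ hω hl hβ hγ N T_L T_R hN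
    hL hR μ inferInstance hstat

/-- Lebesgue measure is absolutely continuous with respect to the Gibbs measure of the pinned chain
at every `T > 0` (the Gibbs density `e^{-H/T}` is positive and integrable). [folklore] -/
theorem volume_absolutelyContinuous_gibbsMeasure {ω₂ lam β : ℝ} (hω : 0 < ω₂) (hl : 0 ≤ lam)
    (hβ : 0 ≤ β) (γ : ℝ) (N : ℕ) {T : ℝ} (hT : 0 < T) :
    (volume : Measure (PhaseSpace N)) ≪ (pinnedChain ω₂ lam β γ).gibbsMeasure N T := by
  rw [OscillatorChain.gibbsMeasure_eq]
  exact absolutelyContinuous_tilted (pinnedChain_integrable_gibbsDensity hω hl hβ γ N hT)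

/-- A weak steady state of the pinned chain (any bath temperatures) is absolutely continuous with
respect to the Gibbs measure at every temperature `T > 0`. [folklore] -/
theorem absolutelyContinuous_gibbsMeasure_of_isSteadyState {ω₂ lam β γ : ℝ} (hω : 0 < ω₂)
    (hl : 0 ≤ lam) (hβ : 0 < β) (hγ : 0 < γ) (hN : 0 < N) {T_L T_R : ℝ} (hL : 0 < T_L)
    (hR : 0 < T_R) {μ : Measure (PhaseSpace N)}
    (hμ : (pinnedChain ω₂ lam β γ).IsSteadyState N T_L T_R μ) {T : ℝ} (hT : 0 < T) :
    μ ≪ (pinnedChain ω₂ lam β γ).gibbsMeasure N T :=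
  (hasSmoothDensity_of_isSteadyState hω hl hβ hγ hN hL hR hμ).absolutelyContinuous.trans
    (volume_absolutelyContinuous_gibbsMeasure hω hl hβ.le γ N hT)

/-- Clause (R1) up to positivity: a weak steady state is the Gibbs state at `T` reweighted by its
Radon–Nikodym derivative, `μ = μ_T · (dμ/dμ_T)`. [folklore] -/
theorem eq_withDensity_rnDeriv_gibbsMeasure_of_isSteadyState {ω₂ lam β γ : ℝ} (hω : 0 < ω₂)
    (hl : 0 ≤ lam) (hβ : 0 < β) (hγ : 0 < γ) (hN : 0 < N) {T_L T_R : ℝ} (hL : 0 < T_L)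
    (hR : 0 < T_R) {μ : Measure (PhaseSpace N)}
    (hμ : (pinnedChain ω₂ lam β γ).IsSteadyState N T_L T_R μ) {T : ℝ} (hT : 0 < T) :
    μ = ((pinnedChain ω₂ lam β γ).gibbsMeasure N T).withDensity
      (μ.rnDeriv ((pinnedChain ω₂ lam β γ).gibbsMeasure N T)) := by
  haveI : IsProbabilityMeasure μ := hμ.1
  haveI := pinnedChain_isProbabilityMeasure_gibbsMeasure hω hl hβ.le γ N hT
  exact (Measure.withDensity_rnDeriv_eq _ _
    (absolutelyContinuous_gibbsMeasure_of_isSteadyState hω hl hβ hγ hN hL hR hμ hT)).symm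

/-! ## 2. The bridge from a positive Lebesgue density to the shape of (R1) -/

/-- **Bookkeeping bridge to (R1).** If `μ = ρ · Leb` with `ρ` measurable and everywhere positive,
then `μ = μ_T · e^{φ}` for the Gibbs measure `μ_T` of the pinned chain at `T > 0`, with the explicit
exponent `φ = log ρ + H/T + log ∫ e^{-H/T}` (measurable). [folklore] -/
theorem eq_gibbsMeasure_withDensity_exp_of_pos_density {ω₂ lam β : ℝ} (hω : 0 < ω₂) (hl : 0 ≤ lam)
    (hβ : 0 ≤ β) (γ : ℝ) (N : ℕ) {T : ℝ} (hT : 0 < T) {μ : Measure (PhaseSpace N)}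
    {ρ : PhaseSpace N → ℝ} (hρm : Measurable ρ) (hρ : ∀ x, 0 < ρ x)
    (hμ : μ = (volume : Measure (PhaseSpace N)).withDensity fun x => ENNReal.ofReal (ρ x)) :
    Measurable (fun x => Real.log (ρ x) + (pinnedChain ω₂ lam β γ).hamiltonian N x / T +
        Real.log (∫ y, (pinnedChain ω₂ lam β γ).gibbsDensity N T y)) ∧
      μ = ((pinnedChain ω₂ lam β γ).gibbsMeasure N T).withDensity fun x =>
        ENNReal.ofReal (Real.exp (Real.log (ρ x) + (pinnedChain ω₂ lam β γ).hamiltonian N x / T +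
          Real.log (∫ y, (pinnedChain ω₂ lam β γ).gibbsDensity N T y))) := by
  set P := pinnedChain ω₂ lam β γ with hP
  have hHm : Measurable (P.hamiltonian N) := (pinnedChain_continuous_hamiltonian ω₂ lam β γ N).measurable
  have hZ : 0 < ∫ y, P.gibbsDensity N T y :=
    integral_exp_pos (pinnedChain_integrable_gibbsDensity hω hl hβ γ N hT)
  refine ⟨((hρm.log).add (hHm.div_const T)).add measurable_const, ?_⟩
  -- the Gibbs measure as a density
  have hgibbs : P.gibbsMeasure N T = (volume : Measure (PhaseSpace N)).withDensity
      fun x => ENNReal.ofReal (P.gibbsDensity N T x / ∫ y, P.gibbsDensity N T y) := rfl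
  have hg1 : Measurable fun x => ENNReal.ofReal (P.gibbsDensity N T x / ∫ y, P.gibbsDensity N T y) :=
    ((pinnedChain_continuous_gibbsDensity ω₂ lam β γ N T).measurable.div_const _).ennreal_ofReal
  have hg2 : Measurable fun x => ENNReal.ofReal (Real.exp (Real.log (ρ x) + P.hamiltonian N x / T +
      Real.log (∫ y, P.gibbsDensity N T y))) :=
    (((hρm.log).add (hHm.div_const T)).add measurable_const).exp.ennreal_ofReal
  rw [hgibbs, ← withDensity_mul _ hg1 hg2, hμ]
  congr 1
  funext x
  simp only [Pi.mul_apply]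
  rw [← ENNReal.ofReal_mul (div_nonneg (P.gibbsDensity_pos N T x).le hZ.le)]
  congr 1
  rw [Real.exp_add, Real.exp_add, Real.exp_log (hρ x), Real.exp_log hZ]
  have hρT : P.gibbsDensity N T x = Real.exp (-P.hamiltonian N x / T) := rfl
  rw [hρT]
  have hZne : (∫ y, P.gibbsDensity N T y) ≠ 0 := hZ.ne'
  have hexp : Real.exp (-P.hamiltonian N x / T) * Real.exp (P.hamiltonian N x / T) = 1 := by
    rw [← Real.exp_add, neg_div, neg_add_cancel, Real.exp_zero]
  have hrew : Real.exp (-P.hamiltonian N x / T) / (∫ y, P.gibbsDensity N T y) *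
      (ρ x * Real.exp (P.hamiltonian N x / T) * ∫ y, P.gibbsDensity N T y) =
      ρ x * (Real.exp (-P.hamiltonian N x / T) * Real.exp (P.hamiltonian N x / T)) *
        ((∫ y, P.gibbsDensity N T y) / ∫ y, P.gibbsDensity N T y) := by ring
  rw [hrew, hexp, div_self hZne, mul_one, mul_one]

/-! ## 3. Uniform-in-`δ` exponential moments of the two-temperature family -/

/-- **Uniform exponential moments along the two-temperature family (registered sub-goal of S1r).**
Under weak-NESS uniqueness, along a steady-state family `μ`, for `T > 0`, `N ≥ 2` and every
`0 < θ < 1/T` there are `δ₀ ∈ (0, 2T)` with `θ < 1/(T + δ₀/2)` and `M` such that for all `|δ| < δ₀`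
the steady state `μ_{N,T+δ/2,T-δ/2}` integrates `e^{θH}` with `∫ e^{θH} dμ_{N,T+δ/2,T-δ/2} ≤ M`.
Proof: the member is invariant for the constructed kernels and integrates `e^{θH}` (`ness_facts`);
integrating the uniform geometric drift `P_1 e^{θH} ≤ e^{θH}/2 + c` (one `c` for all baths at
temperatures `≤ T + δ₀/2`, `pinnedChain_drift_uniform`) gives `∫ e^{θH} ≤ ∫ e^{θH}/2 + c`.
[cite: CuneoEckmannHairerReyBellet2018, Thm 2.13 (2) and Rem 5.2] -/
theorem ness_uniform_exp_moment :
    ∀ ω₂ lam β γ : ℝ, 0 < ω₂ → 0 < lam → 0 < β → 0 < γ →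
      (∀ (N : ℕ) (T_L T_R : ℝ), 0 < T_L → 0 < T_R → ∀ μ ν : Measure (PhaseSpace N),
        (pinnedChain ω₂ lam β γ).IsSteadyState N T_L T_R μ →
        (pinnedChain ω₂ lam β γ).IsSteadyState N T_L T_R ν → μ = ν) →
      ∀ μ : (N : ℕ) → ℝ → ℝ → Measure (PhaseSpace N),
        (∀ (N : ℕ) (T_L T_R : ℝ), 0 < T_L → 0 < T_R →
          (pinnedChain ω₂ lam β γ).IsSteadyState N T_L T_R (μ N T_L T_R)) →
        ∀ T : ℝ, 0 < T → ∀ N : ℕ, 2 ≤ N → ∀ θ : ℝ, 0 < θ → θ < 1 / T →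
          ∃ δ₀ M : ℝ, 0 < δ₀ ∧ δ₀ < 2 * T ∧ θ < 1 / (T + δ₀ / 2) ∧ 0 ≤ M ∧
            ∀ δ : ℝ, |δ| < δ₀ →
              Integrable (fun x => Real.exp (θ * (pinnedChain ω₂ lam β γ).hamiltonian N x))
                  (μ N (T + δ / 2) (T - δ / 2)) ∧
                ∫ x, Real.exp (θ * (pinnedChain ω₂ lam β γ).hamiltonian N x)
                    ∂(μ N (T + δ / 2) (T - δ / 2)) ≤ M := by
  intro ω₂ lam β γ hω hl hβ hγ huniq μ hμ T hT N hN θ hθ hθT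
  set P := pinnedChain ω₂ lam β γ with hP
  have hN0 : 0 < N := by omega
  -- the width: `T + δ₀/2 < 1/θ` and `δ₀ ≤ T`
  have hinvθ : T < 1 / θ := (lt_one_div hT hθ).2 hθT
  set s : ℝ := 1 / θ - T with hs
  have hs0 : 0 < s := by rw [hs]; linarith
  set δ₀ : ℝ := min T s with hδ₀
  have hδ₀0 : 0 < δ₀ := lt_min hT hs0
  have hδ₀T : δ₀ ≤ T := min_le_left _ _
  have hδ₀s : δ₀ ≤ s := min_le_right _ _
  set Tmax : ℝ := T + δ₀ / 2 with hTmax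
  have hTmax0 : 0 < Tmax := by positivity
  have hTmaxθ : Tmax < 1 / θ := by rw [hTmax]; linarith
  have hθ' : θ < 1 / Tmax := by
    rw [lt_one_div hθ hTmax0]; exact hTmaxθ
  -- the uniform drift at time `1`
  obtain ⟨c, hc, hdrift⟩ :=
    Summit.AtomisticToContinuum.FouriersLaw.Theorems.OddSectorIrreversibility.Corrector.pinnedChain_drift_uniform
      hω hl.le hβ hγ hN0 hTmax0 hθ hθ' 1 one_pos
  refine ⟨δ₀, 2 * c, hδ₀0, by linarith, hθ', by positivity, fun δ hδ => ?_⟩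
  have h1 := abs_lt.1 hδ
  have hL : 0 < T + δ / 2 := by linarith
  have hR : 0 < T - δ / 2 := by linarith
  have hLm : T + δ / 2 ≤ Tmax := by rw [hTmax]; linarith
  have hRm : T - δ / 2 ≤ Tmax := by rw [hTmax]; linarith
  obtain ⟨hprob, hinv, hint, -⟩ :=
    Summit.AtomisticToContinuum.FouriersLaw.Theorems.BondHeatUncertainty.ness_facts ω₂ lam β γ hω hl hβ
      hγ huniq μ hμ N hN (T + δ / 2) (T - δ / 2) hL hR
  have hmax0 : 0 < max (T + δ / 2) (T - δ / 2) := lt_max_of_lt_left hL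
  have hθmax : θ < 1 / max (T + δ / 2) (T - δ / 2) :=
    hθ'.trans_le (one_div_le_one_div_of_le hmax0 (max_le hLm hRm))
  have hI := hint θ hθ hθmax
  refine ⟨hI, ?_⟩
  set ν := μ N (T + δ / 2) (T - δ / 2) with hν
  set V : PhaseSpace N → ℝ≥0∞ := fun x => ENNReal.ofReal (Real.exp (θ * P.hamiltonian N x)) with hV
  have hVm : Measurable V :=
    (Real.continuous_exp.comp (continuous_const.mul
      (pinnedChain_continuous_hamiltonian ω₂ lam β γ N))).measurable.ennreal_ofReal
  set A : ℝ≥0∞ := ∫⁻ x, V x ∂ν with hA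
  have hAfin : A ≠ ⊤ := hI.lintegral_lt_top.ne
  -- invariance: `A = ∫ (∫ V dP_1(z,·)) dν(z) ≤ A/2 + c`
  have hκm : Measurable ⇑(P.transitionKernel N (T + δ / 2) (T - δ / 2) 1) :=
    (P.transitionKernel N (T + δ / 2) (T - δ / 2) 1).measurable
  have hAle : A ≤ 2⁻¹ * A + ENNReal.ofReal c := by
    calc A = ∫⁻ x, V x ∂(ν.bind ⇑(P.transitionKernel N (T + δ / 2) (T - δ / 2) 1)) := by
          rw [hinv 1]
      _ = ∫⁻ z, ∫⁻ y, V y ∂(P.transitionKernel N (T + δ / 2) (T - δ / 2) 1 z) ∂ν :=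
          Measure.lintegral_bind hκm.aemeasurable hVm.aemeasurable
      _ ≤ ∫⁻ z, (2⁻¹ * V z + ENNReal.ofReal c) ∂ν := by
          refine lintegral_mono fun z => (hdrift _ _ hL hR hLm hRm z).trans (le_of_eq ?_)
          rw [hV]
          simp only
          rw [ENNReal.ofReal_add (by positivity) hc.le, ENNReal.ofReal_mul (by norm_num),
            ENNReal.ofReal_div_of_pos two_pos, ENNReal.ofReal_one, one_div, ENNReal.ofReal_ofNat]
      _ = 2⁻¹ * A + ENNReal.ofReal c := by
          rw [lintegral_add_right _ measurable_const, lintegral_const_mul _ hVm, lintegral_const,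
            measure_univ, mul_one]
  -- hence `A ≤ 2c`
  have hA2 : A ≤ ENNReal.ofReal (2 * c) := by
    have hhalf : 2⁻¹ * A ≠ ⊤ := ENNReal.mul_ne_top (by simp) hAfin
    have h2 : A = 2⁻¹ * A + 2⁻¹ * A := by
      rw [← add_mul, ENNReal.inv_two_add_inv_two, one_mul]
    have h3 : 2⁻¹ * A + 2⁻¹ * A ≤ 2⁻¹ * A + ENNReal.ofReal c := h2 ▸ hAle
    have h4 : 2⁻¹ * A ≤ ENNReal.ofReal c := (ENNReal.add_le_add_iff_left hhalf).1 h3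
    calc A = 2⁻¹ * A + 2⁻¹ * A := h2
      _ ≤ ENNReal.ofReal c + ENNReal.ofReal c := add_le_add h4 h4
      _ = ENNReal.ofReal (2 * c) := by rw [← ENNReal.ofReal_add hc.le hc.le, two_mul]
  -- back to the Bochner integral
  rw [integral_eq_lintegral_of_nonneg_ae (Eventually.of_forall fun x => (Real.exp_pos _).le)
    hI.aestronglyMeasurable]
  have : (∫⁻ x, ENNReal.ofReal (Real.exp (θ * P.hamiltonian N x)) ∂ν) = A := rfl
  rw [this]
  calc A.toReal ≤ (ENNReal.ofReal (2 * c)).toReal := ENNReal.toReal_mono ENNReal.ofReal_ne_top hA2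
    _ = 2 * c := ENNReal.toReal_ofReal (by positivity)

end LogDensity

end Summit.AtomisticToContinuum.FouriersLaw.Theorems.ExtensiveSnapshotIrreversibility.ClausiusBudget

end
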